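import Summits.BirchSwinnertonDyer.BirchSwinnertonDyer.Theorems.InertBadSignedBranchesInertBadAtThreeQuarticValueExit
import Summits.BirchSwinnertonDyer.BirchSwinnertonDyer.Theorems.InertBadSignedBranchesInertBadAtThreeQuarticModelUnit
import Summits.BirchSwinnertonDyer.BirchSwinnertonDyer.Theorems.InertBadSignedBranchesInertBadAtThreeQuarticModelKRange
import Summits.BirchSwinnertonDyer.BirchSwinnertonDyer.Theorems.InertBadSignedBranchesInertBadAtThreeQuarticCleanAssemblyOdd
import HarnessLib

/-!
# The registered stub `stub_plainOddNeronIntegralThreeQuartic` (v5) REDUCED to the `f`-free odd twisted-value statement for the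
# fourth-power-free quartic MODELS `y² = x³ + Ax`, `3 ∣ A`, `v₃(A) ∈ {1,2,3}`, `ℓ ∤ A`

Summit `BirchSwinnertonDyer`, crux `InertBadAtThree` (stmt-BirchSwinnertonDyer-19225), line of record `Lines/rubin_e1_inert_three.lean` v5
(sha16 cf92aff39960433f), registered stub `stub_plainOddNeronIntegralThreeQuartic`; STUB-PLAN
`Cruxes/InertBadAtThree/STUB-PLAN-neronIntegralThreeQuartic-bsd-idea-18-g8.md` (P0 + P1a + P2 + the V-level glue of P6). Width seat
bsd-wall-cm-bed-w3 g8 (`--supports 19225`, helper) — item (b) of the lead `bsd-line-ibd-p1` g7's 11:37:51Z line, in the form that does NOT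
wait for Part B: the lead's model-level conclusion enters as the hypothesis `h`.

* `plainOddNeronIntegralThreeQuartic_of_modelOddLValues` — the registered stub's statement VERBATIM follows from:
  «for every `A ∈ ℤ ∖ 0` with `3 ∣ A`, `p⁴ ∤ A` for all primes `p` (so `1 ≤ v₃(A) ≤ 3`, supplied), every prime `ℓ ≡ 11 (mod 12)` with `ℓ ∤ A`,
  and every odd `χ` mod `ℓ` with `χ(3) ≠ 1`: SOME entire `L` with `L(s) = Σ χ̄(n)a_n(E_A)n⁻ˢ` (`re s > 2`, `E_A = ⟨0,0,0,A,0⟩`) has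
  `s·τ(χ)·L(1)/(i·Ω⁻(E_A)) ∈ ℤ̄` for some `3 ∤ s`» — the MODEL-level odd statement (the lead's Part B target; `Ω⁻(E_A) = c·ϖ₀|A|^{−1/4}`,
  `c ∈ {1, √2}`, by `…QuarticModelPeriods`).
  Chain: `…QuarticModelUnit.exists_smul_eq_quartic_fourthPowerFree` (model `C • V = E_A`, `v₃(u_C) = 0`, `A` fourth-power-free, from bed-w2's
  P1a) → `not_dvd_quartic_of_not_dvd_conductorNorm` (`ℓ ∤ N_V ⇒ ℓ ∤ A`) → `h` → `…QuarticModel.LValueOdd_of_smul` (transport to `V`,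
  `3 ∤ den u_C`) → `…QuarticValueExit.plainOdd_of_LValue` (Birch; odd characters of prime modulus are primitive).

* `plainOddNeronIntegralThreeQuartic_of_dictionary` — ★ the registered stub VERBATIM modulo ONE hypothesis, the THETA DICTIONARY for
  models (STUB-PLAN P1b; bed-w4 g9 / bed-w2 g9): with the lead's P6 Part B `…QuarticCleanAssembly.oddLValue_quartic_of_dictionary` (p631134)
  supplying the model-level statement from the dictionary `Σ χ̄(n)a_n(E_A)n⁻ˢ = ¼·Θ-L_{3M′}(conj(χ₄)^{v₃ A}·Ψ′)(s)` (`χ₄ = (·/3)₄` through the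
  table hypothesis `hq`, as in the lead's files), `k := v₃(A) ∈ {1,2,3}` from `…QuarticModelKRange`.

HONEST FRAMING: this closes nothing by itself — the remaining hypothesis is the theta dictionary (P1b). No definition, no named fact,
no `sorry`; axioms standard. BSD is not proved by any of this.
-/

set_option autoImplicit false
set_option linter.dupNamespace false

noncomputable section

open scoped ComplexConjugate
open Complex WeierstrassCurve
open Literature.NumberTheory.LFunctions Literature.NumberTheory.LFunctions.GaussianTheta
open Literature.NumberTheory.EllipticCurves Literature.NumberTheory.EllipticCurves.ModularForms

namespace Summit.BirchSwinnertonDyer.BirchSwinnertonDyer.Theorems.InertBadSignedBranchesInertBadAtThreeQuarticStubOfModel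

open Summit.BirchSwinnertonDyer.BirchSwinnertonDyer.Theorems.ManinLocalTwoThree (isPrimitive_of_odd)
open Summit.BirchSwinnertonDyer.BirchSwinnertonDyer.Theorems.InertBadSignedBranchesInertBadAtThreeQuarticValueExit (plainOdd_of_LValue)
open Summit.BirchSwinnertonDyer.BirchSwinnertonDyer.Theorems.InertBadSignedBranchesInertBadAtThreeQuarticModel (LValueOdd_of_smul)
open Summit.BirchSwinnertonDyer.BirchSwinnertonDyer.Theorems.InertBadSignedBranchesInertBadAtThreeQuarticModelUnit
  (exists_smul_eq_quartic_fourthPowerFree not_dvd_quartic_of_not_dvd_conductorNorm)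
open Summit.BirchSwinnertonDyer.BirchSwinnertonDyer.Theorems.InertBadSignedBranchesInertBadAtThreeQuarticModelKRange
  (padicValInt_le_three_of_smul_eq_quartic not_pow_four_dvd_of_smul_eq_quartic)
open Summit.BirchSwinnertonDyer.BirchSwinnertonDyer.Theorems.InertBadSignedBranchesInertBadAtThreeQuarticCleanAssembly
  (oddLValue_quartic_of_dictionary)

/-- ★ **The registered stub `stub_plainOddNeronIntegralThreeQuartic` (its statement VERBATIM) from the MODEL-level odd twisted-value
integrality.** Hypothesis `h`: for every `A ∈ ℤ ∖ 0` with `3 ∣ A`, fourth-power-free (`p⁴ ∤ A` for all primes `p`), `1 ≤ v₃(A) ≤ 3`, every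
prime `ℓ ≡ 11 (mod 12)` with `ℓ ∤ A`, every odd `χ` mod `ℓ` with `χ(3) ≠ 1`: some entire `L` continuing `Σ χ̄(n)a_n(⟨0,0,0,A,0⟩)n⁻ˢ` has
`s·τ(χ)·L(1)/(i·Ω⁻(⟨0,0,0,A,0⟩)) ∈ ℤ̄` with `3 ∤ s`. Conclusion: the v5 stub of line `rubin_e1_inert_three` (conductor level, odd `χ` of prime
modulus `ℓ ∤ N_V`, `ℓ ≡ 11 (12)`, `χ(3) ≠ 1`, binders `(ϖ, r)`). [cite: SilvermanAEC2009, X.5.4 (iii)] [cite: MazurTateTeitelbaum1986, §I.8 (8.6)] -/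
theorem plainOddNeronIntegralThreeQuartic_of_modelOddLValues
    (h : ∀ (A : ℤ), A ≠ 0 → (3 : ℤ) ∣ A → (∀ p : ℕ, p.Prime → ¬ ((p : ℤ) ^ 4 ∣ A)) →
      1 ≤ padicValInt 3 A → padicValInt 3 A ≤ 3 →
      ∀ (ℓ : ℕ) [NeZero ℓ], ℓ.Prime → ℓ % 12 = 11 → ¬ (ℓ : ℤ) ∣ A →
      ∀ χ : DirichletCharacter ℂ ℓ, χ.Odd → χ (3 : ZMod ℓ) ≠ 1 →
      ∃ L : ℂ → ℂ, Differentiable ℂ L ∧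
        (∀ s : ℂ, 2 < s.re → L s = LSeries (fun n : ℕ ↦ χ⁻¹ (n : ZMod ℓ) *
          ((⟨0, 0, 0, (A : ℚ), 0⟩ : WeierstrassCurve ℚ).LFunction n : ℂ)) s) ∧
        ∃ s : ℕ, ¬ 3 ∣ s ∧ IsIntegral ℤ ((s : ℂ) * (gaussSum χ (ZMod.stdAddChar (N := ℓ)) * L 1 /
          (Complex.I * ((⟨0, 0, 0, (A : ℚ), 0⟩ : WeierstrassCurve ℚ).imaginaryPeriodRat : ℂ))))) :
    ∀ (V : WeierstrassCurve ℚ) [V.IsElliptic] [V.IsGloballyMinimal] [NeZero (V.conductorNorm ℤ)],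
      V.j = 1728 → ¬ V.HasGoodReductionAtPrime 3 →
      ∀ (f : CuspForm (CongruenceSubgroup.Gamma0 (V.conductorNorm ℤ)) 2),
        Literature.NumberTheory.EllipticCurves.ModularForms.IsNewformOf V f →
      ∀ (ℓ : ℕ) [NeZero ℓ], ℓ.Prime → ¬ ℓ ∣ V.conductorNorm ℤ → ℓ % 12 = 11 →
      ∀ χ : DirichletCharacter ℂ ℓ, χ.Odd → χ (3 : ZMod ℓ) ≠ 1 →
      ∀ (ϖ : ℚ) (r : ℂ), (ϖ : ℝ) * V.imaginaryPeriodRat = Literature.NumberTheory.EllipticCurves.ModularForms.minusPeriod f →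
        Literature.NumberTheory.EllipticCurves.ModularForms.twistedSymbolSum f χ =
          r * (Literature.NumberTheory.EllipticCurves.ModularForms.minusPeriod f : ℂ) * Complex.I →
        ∃ s : ℕ, ¬ 3 ∣ s ∧ IsIntegral ℤ ((s : ℂ) * ϖ * r) := by
  intro V _ _ _ hj hbad f hf ℓ _ hℓ hℓN h12 χ hχ hχ3 ϖ r hϖ hr
  haveI : Fact ℓ.Prime := ⟨hℓ⟩
  haveI : Fact (Nat.Prime 3) := ⟨Nat.prime_three⟩
  obtain ⟨A, C, hCV, hA0, h3A, h4, hu⟩ := exists_smul_eq_quartic_fourthPowerFree V hj hbad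
  have hℓ2 : ℓ ≠ 2 := by omega
  have hℓA : ¬ (ℓ : ℤ) ∣ A := not_dvd_quartic_of_not_dvd_conductorNorm V hCV h4 hℓ hℓ2 hℓN
  have hk1 : 1 ≤ padicValInt 3 A := by
    rcases (padicValInt_dvd_iff (p := 3) 1 A).mp (by simpa using h3A) with h' | h'
    · exact absurd h' hA0
    · exact h'
  have hk3 : padicValInt 3 A ≤ 3 := padicValInt_le_three_of_smul_eq_quartic V hCV hu
  have hmodel := h A hA0 h3A h4 hk1 hk3 ℓ hℓ h12 hℓA χ hχ hχ3
  have hV := LValueOdd_of_smul (p := 3) V C (KramerTwoDescent.not_dvd_den_of_padicValRat_eq_zero hu) χ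
    (by rw [hCV]; exact hmodel)
  exact plainOdd_of_LValue V hf (isPrimitive_of_odd hχ) hV hϖ hr

/-! ## The stub modulo the theta dictionary (P1b) -/

section Dictionary

variable {q : GaussianInt → ℂ}
  (hq : ∀ x : GaussianInt, q x =
    if (3 : ℤ) ∣ x.re ∧ (3 : ℤ) ∣ x.im then 0
    else if (3 : ℤ) ∣ x.im then 1
    else if (3 : ℤ) ∣ x.re then -1
    else if (3 : ℤ) ∣ x.re - x.im then -I
    else I)

include hq

/-- ★ **The registered stub `stub_plainOddNeronIntegralThreeQuartic` VERBATIM, modulo the THETA DICTIONARY for quartic models (STUB-PLAN P1b).**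
Hypothesis `hdictAll`: for every `A ∈ ℤ ∖ 0` with `3 ∣ A`, fourth-power-free (so `3⁴ ∤ A`), every prime `ℓ ≡ 11 (mod 12)` with `ℓ ∤ A` and
every odd `χ` mod `ℓ` with `χ(3) ≠ 1`, there are `M′` with `(3, M′) = 1` and an `M′`-periodic `Ψ′ : ℤ[i] → ℂ` with algebraic-integer values
such that `Σ χ̄(n)a_n(⟨0,0,0,A,0⟩)n⁻ˢ = ¼·Θ-L_{3M′}(conj(q)^{v₃(A)}·Ψ′)(s)` for `re s > 2` (`q = (·/3)₄` through `hq`). Chain: fourth-power-free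
model with `v₃(u_C) = 0` (`…QuarticModelUnit`), `k := v₃(A) ∈ {1,2,3}` (`…QuarticModelKRange`), `ℓ ∤ A` (`ℓ ∤ N_V`), the lead's P6 Part B
`oddLValue_quartic_of_dictionary` (p631134), transport `LValueOdd_of_smul` (p628739), value exit `plainOdd_of_LValue` (p627747).
[cite: Rubin1999, Prop. 7.15] [cite: MazurTateTeitelbaum1986, §I.8 (8.6)] [cite: SilvermanAEC2009, X.5.4 (iii)] -/
theorem plainOddNeronIntegralThreeQuartic_of_dictionary
    (hdictAll : ∀ (A : ℤ), A ≠ 0 → (3 : ℤ) ∣ A → (∀ p : ℕ, p.Prime → ¬ ((p : ℤ) ^ 4 ∣ A)) →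
      ∀ (ℓ : ℕ) [NeZero ℓ], ℓ.Prime → ℓ % 12 = 11 → ¬ (ℓ : ℤ) ∣ A →
      ∀ χ : DirichletCharacter ℂ ℓ, χ.Odd → χ (3 : ZMod ℓ) ≠ 1 →
      ∃ (M' : ℕ) (_ : NeZero M') (_ : NeZero (3 * M')) (Ψ : GaussianInt → ℂ),
        Nat.Coprime 3 M' ∧ (∀ x y : GaussianInt, Ψ (x + M' * y) = Ψ x) ∧ (∀ x : GaussianInt, IsIntegral ℤ (Ψ x)) ∧
        ∀ s : ℂ, 2 < s.re →
          LSeries (fun n : ℕ ↦ χ⁻¹ (n : ZMod ℓ) * ((⟨0, 0, 0, (A : ℚ), 0⟩ : WeierstrassCurve ℚ).LFunction n : ℂ)) s =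
            (1 / 4 : ℂ) * thetaLFunction (3 * M') (fun x ↦ (conj (q x)) ^ (padicValInt 3 A) * Ψ x) s) :
    ∀ (V : WeierstrassCurve ℚ) [V.IsElliptic] [V.IsGloballyMinimal] [NeZero (V.conductorNorm ℤ)],
      V.j = 1728 → ¬ V.HasGoodReductionAtPrime 3 →
      ∀ (f : CuspForm (CongruenceSubgroup.Gamma0 (V.conductorNorm ℤ)) 2),
        Literature.NumberTheory.EllipticCurves.ModularForms.IsNewformOf V f →
      ∀ (ℓ : ℕ) [NeZero ℓ], ℓ.Prime → ¬ ℓ ∣ V.conductorNorm ℤ → ℓ % 12 = 11 →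
      ∀ χ : DirichletCharacter ℂ ℓ, χ.Odd → χ (3 : ZMod ℓ) ≠ 1 →
      ∀ (ϖ : ℚ) (r : ℂ), (ϖ : ℝ) * V.imaginaryPeriodRat = Literature.NumberTheory.EllipticCurves.ModularForms.minusPeriod f →
        Literature.NumberTheory.EllipticCurves.ModularForms.twistedSymbolSum f χ =
          r * (Literature.NumberTheory.EllipticCurves.ModularForms.minusPeriod f : ℂ) * Complex.I →
        ∃ s : ℕ, ¬ 3 ∣ s ∧ IsIntegral ℤ ((s : ℂ) * ϖ * r) := by
  refine plainOddNeronIntegralThreeQuartic_of_modelOddLValues ?_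
  intro A hA0 h3A h4 hk1 hk3 ℓ _ hℓ h12 hℓA χ hχ hχ3
  obtain ⟨M', _, _, Ψ, h3, hΨ, hΨint, hdict⟩ := hdictAll A hA0 h3A h4 ℓ hℓ h12 hℓA χ hχ hχ3
  have hkA : 3 ^ padicValInt 3 A ∣ A.natAbs := pow_padicValNat_dvd
  exact oddLValue_quartic_of_dictionary hq A hA0 hk1 hk3 hkA χ h3 Ψ hΨ hΨint hdict

end Dictionary

end Summit.BirchSwinnertonDyer.BirchSwinnertonDyer.Theorems.InertBadSignedBranchesInertBadAtThreeQuarticStubOfModel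

end
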